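import Literature.NumberTheory.EllipticCurves.Greenberg1999.TwoTorsionQuadraticTwistPairTypeProofs
import HarnessLib

/-!
# The type of a `ℤ/2`-linked pair (R₁ / M₁ / R₂ / M₂) is well defined: read at either end of the `2`-isogeny it is
# the same, and every pair has exactly one type (proofs only)

Topic `NumberTheory/EllipticCurves/Greenberg1999`; theorem-only companion (no definition, no named fact, no instance, no `sorry`)
of `TwoTorsionQuadraticTwistPairTypeProofs` (the four pair types and their twists) and of the duality files
(`TwoTorsion{Odd,Ramified}IsogenyDualProofs`, `TwoTorsionIsogenyDiscriminantSignProofs`).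

Setting: `W, W'` globally minimal with `a₁` odd (good ordinary or multiplicative at `2`), `C • W` a two-torsion normal form
exhibiting the rational point `P = (C.r, C.t)` of order `2`, `C' • W' = (C • W).twoIsogenyCodomain`, `P' = (C'.r, C'.t)` the
generator of the dual kernel.  Member-level descriptions of the four types of the pair `{(W,P), (W',P')}` (spelled inline, no
definition): with «middle» = neither odd nor co-odd,
* R₁ : (`P` ramified ∧ odd ∧ `Δ(W) < 0`) ∨ (`P` unramified ∧ middle);
* M₁ : (`P` unramified ∧ odd ∧ `Δ(W) < 0`) ∨ (`P` ramified ∧ middle);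
* R₂ : `Δ(W) > 0` ∧ ((`P` ramified ∧ odd) ∨ (`P` unramified ∧ co-odd ∧ not odd));
* M₂ : `Δ(W) > 0` ∧ ((`P` unramified ∧ odd) ∨ (`P` ramified ∧ co-odd ∧ not odd)).

**Theorems.** `typeR₁_iff_of_twoIsogeny`, `typeM₁_iff_of_twoIsogeny`, `typeR₂_iff_of_twoIsogeny`, `typeM₂_iff_of_twoIsogeny` — each
description holds at `(W, P)` iff it holds at `(W', P')`; `type_cases` — every rational `2`-torsion point satisfies exactly one of
the four (exhaustive: `type_cases`; the four are pairwise exclusive by the sign of `Δ` and the flags).  So «the type of the pair» is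
a well-defined invariant of the unordered pair, as used by the BSD cell `bsd-2adic` (stratum (β) atoms A₁ ⊇ R₁-members,
A₂ ⊇ M₁-members, A₃ = R₂ ∪ M₂-members).  Nothing about `μ`, `λ` or BSD is claimed.

## References
* [GreenbergLNM1716] R. Greenberg, *Iwasawa theory for elliptic curves*, LNM 1716 (1999), §5 Props. 5.13–5.14 and Remarks
  (chunks p0168–p0174).
* [SilvermanAEC2009] J. H. Silverman, *AEC*, III.4 Example 4.5, III.6.1.
-/

set_option autoImplicit false

open WeierstrassCurve

namespace Literature.NumberTheory.EllipticCurves.Greenberg1999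

section PairType

variable (W W' : WeierstrassCurve ℚ) [W.IsElliptic] [W.IsGloballyMinimal] [W'.IsElliptic] [W'.IsGloballyMinimal]
  (C C' : VariableChange ℚ)

/-- **Type R₁ read at either end**: (`P` 5.13 with `Δ(W) < 0`, or `P` unramified-middle) iff the same for `(W', P')`.
[cite: GreenbergLNM1716, §5 Props. 5.13–5.14 and Remarks (chunks p0168–p0174)] -/
theorem typeR₁_iff_of_twoIsogeny (ha₁ : Odd (integralModelInt W).a₁) (ha₁' : Odd (integralModelInt W').a₁)
    [(C • W).IsTwoTorsionNF] (hlink : C' • W' = (C • W).twoIsogenyCodomain) :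
    ((TwoTorsionRamifiedAtTwo C.r ∧ TwoTorsionOdd W C.r ∧ W.Δ < 0) ∨
      (¬ TwoTorsionRamifiedAtTwo C.r ∧ ¬ TwoTorsionOdd W C.r ∧
        ¬ ∀ r : ℝ, 4 * r ^ 3 + (W.b₂ : ℝ) * r ^ 2 + 2 * (W.b₄ : ℝ) * r + (W.b₆ : ℝ) = 0 → r ≤ (C.r : ℝ))) ↔
    ((TwoTorsionRamifiedAtTwo C'.r ∧ TwoTorsionOdd W' C'.r ∧ W'.Δ < 0) ∨
      (¬ TwoTorsionRamifiedAtTwo C'.r ∧ ¬ TwoTorsionOdd W' C'.r ∧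
        ¬ ∀ r : ℝ, 4 * r ^ 3 + (W'.b₂ : ℝ) * r ^ 2 + 2 * (W'.b₄ : ℝ) * r + (W'.b₆ : ℝ) = 0 → r ≤ (C'.r : ℝ))) := by
  haveI : (C' • W').IsTwoTorsionNF := by rw [hlink]; infer_instance
  have hR := twoTorsionRamifiedAtTwo_iff_not_of_twoIsogeny W W' ha₁ ha₁' C C' hlink
  have hO := twoTorsionOdd_iff_not_of_twoIsogeny W W' C C' hlink
  have hmid := Δ_partner_neg_iff_middle W W' C C' hlink
  have hmid' := Δ_neg_iff_partner_middle W W' C C' hlink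
  tauto

/-- **Type M₁ read at either end**: (`P` unramified-odd with `Δ(W) < 0`, or `P` ramified-middle) iff the same for `(W', P')`.
[cite: GreenbergLNM1716, §5 Props. 5.13–5.14 and Remarks (chunks p0168–p0174)] -/
theorem typeM₁_iff_of_twoIsogeny (ha₁ : Odd (integralModelInt W).a₁) (ha₁' : Odd (integralModelInt W').a₁)
    [(C • W).IsTwoTorsionNF] (hlink : C' • W' = (C • W).twoIsogenyCodomain) :
    ((¬ TwoTorsionRamifiedAtTwo C.r ∧ TwoTorsionOdd W C.r ∧ W.Δ < 0) ∨
      (TwoTorsionRamifiedAtTwo C.r ∧ ¬ TwoTorsionOdd W C.r ∧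
        ¬ ∀ r : ℝ, 4 * r ^ 3 + (W.b₂ : ℝ) * r ^ 2 + 2 * (W.b₄ : ℝ) * r + (W.b₆ : ℝ) = 0 → r ≤ (C.r : ℝ))) ↔
    ((¬ TwoTorsionRamifiedAtTwo C'.r ∧ TwoTorsionOdd W' C'.r ∧ W'.Δ < 0) ∨
      (TwoTorsionRamifiedAtTwo C'.r ∧ ¬ TwoTorsionOdd W' C'.r ∧
        ¬ ∀ r : ℝ, 4 * r ^ 3 + (W'.b₂ : ℝ) * r ^ 2 + 2 * (W'.b₄ : ℝ) * r + (W'.b₆ : ℝ) = 0 → r ≤ (C'.r : ℝ))) := by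
  haveI : (C' • W').IsTwoTorsionNF := by rw [hlink]; infer_instance
  have hR := twoTorsionRamifiedAtTwo_iff_not_of_twoIsogeny W W' ha₁ ha₁' C C' hlink
  have hO := twoTorsionOdd_iff_not_of_twoIsogeny W W' C C' hlink
  have hmid := Δ_partner_neg_iff_middle W W' C C' hlink
  have hmid' := Δ_neg_iff_partner_middle W W' C C' hlink
  tauto

/-- **Type R₂ read at either end**: `Δ(W) > 0` with `P` 5.13 or unramified-co-odd-not-odd iff the same for `(W', P')`.
[cite: GreenbergLNM1716, §5 Props. 5.13–5.14 and Remarks (chunks p0168–p0174)] -/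
theorem typeR₂_iff_of_twoIsogeny (ha₁ : Odd (integralModelInt W).a₁) (ha₁' : Odd (integralModelInt W').a₁)
    [(C • W).IsTwoTorsionNF] (hlink : C' • W' = (C • W).twoIsogenyCodomain) :
    (0 < W.Δ ∧ ((TwoTorsionRamifiedAtTwo C.r ∧ TwoTorsionOdd W C.r) ∨
      (¬ TwoTorsionRamifiedAtTwo C.r ∧ ¬ TwoTorsionOdd W C.r ∧
        ∀ r : ℝ, 4 * r ^ 3 + (W.b₂ : ℝ) * r ^ 2 + 2 * (W.b₄ : ℝ) * r + (W.b₆ : ℝ) = 0 → r ≤ (C.r : ℝ)))) ↔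
    (0 < W'.Δ ∧ ((TwoTorsionRamifiedAtTwo C'.r ∧ TwoTorsionOdd W' C'.r) ∨
      (¬ TwoTorsionRamifiedAtTwo C'.r ∧ ¬ TwoTorsionOdd W' C'.r ∧
        ∀ r : ℝ, 4 * r ^ 3 + (W'.b₂ : ℝ) * r ^ 2 + 2 * (W'.b₄ : ℝ) * r + (W'.b₆ : ℝ) = 0 → r ≤ (C'.r : ℝ)))) := by
  haveI : (C' • W').IsTwoTorsionNF := by rw [hlink]; infer_instance
  obtain ⟨hlink', hr''⟩ := smul_eq_twoIsogenyCodomain_partner W W' C C' hlink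
  have hR := twoTorsionRamifiedAtTwo_iff_not_of_twoIsogeny W W' ha₁ ha₁' C C' hlink
  have hO := twoTorsionOdd_iff_not_of_twoIsogeny W W' C C' hlink
  -- sign facts along the pair and along the dual pair (whose kernel point has the same abscissa `C.r`)
  have h1 : TwoTorsionOdd W C.r → 0 < W'.Δ := Δ_partner_pos_of_twoTorsionOdd W W' C C' hlink
  have h2 : (∀ r : ℝ, 4 * r ^ 3 + (W.b₂ : ℝ) * r ^ 2 + 2 * (W.b₄ : ℝ) * r + (W.b₆ : ℝ) = 0 → r ≤ (C.r : ℝ)) →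
      0 < W'.Δ := Δ_partner_pos_of_coodd W W' C C' hlink
  have h1' : TwoTorsionOdd W' C'.r → 0 < W.Δ := Δ_partner_pos_of_twoTorsionOdd W' W C' _ hlink'
  have h2' : (∀ r : ℝ, 4 * r ^ 3 + (W'.b₂ : ℝ) * r ^ 2 + 2 * (W'.b₄ : ℝ) * r + (W'.b₆ : ℝ) = 0 → r ≤ (C'.r : ℝ)) →
      0 < W.Δ := Δ_partner_pos_of_coodd W' W C' _ hlink'
  have h3 : TwoTorsionRamifiedAtTwo C.r → TwoTorsionOdd W C.r → 0 < W.Δ →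
      ∀ r : ℝ, 4 * r ^ 3 + (W'.b₂ : ℝ) * r ^ 2 + 2 * (W'.b₄ : ℝ) * r + (W'.b₆ : ℝ) = 0 → r ≤ (C'.r : ℝ) := by
    intro hr ho hΔ
    obtain ⟨-, -, -, hcases⟩ := partner_middle_or_coodd_of_ramified_odd W W' C C' ha₁ ha₁' hlink hr ho
    rcases hcases with ⟨hneg, _⟩ | ⟨_, hco'⟩
    · exact absurd hneg (not_lt.mpr hΔ.le)
    · exact hco'
  have h3' : TwoTorsionRamifiedAtTwo C'.r → TwoTorsionOdd W' C'.r → 0 < W'.Δ →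
      ∀ r : ℝ, 4 * r ^ 3 + (W.b₂ : ℝ) * r ^ 2 + 2 * (W.b₄ : ℝ) * r + (W.b₆ : ℝ) = 0 → r ≤ (C.r : ℝ) := by
    intro hr ho hΔ
    obtain ⟨-, -, -, hcases⟩ := partner_middle_or_coodd_of_ramified_odd W' W C' _ ha₁' ha₁ hlink' hr ho
    rw [hr''] at hcases
    rcases hcases with ⟨hneg, _⟩ | ⟨_, hco⟩
    · exact absurd hneg (not_lt.mpr hΔ.le)
    · exact hco
  have r'_of : ¬ TwoTorsionRamifiedAtTwo C.r → TwoTorsionRamifiedAtTwo C'.r := fun h ↦ by_contra fun h' ↦ h (hR.mpr h')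
  have o'_of : ¬ TwoTorsionOdd W C.r → TwoTorsionOdd W' C'.r := fun h ↦ by_contra fun h' ↦ h (hO.mpr h')
  constructor
  · rintro ⟨hΔ, ⟨hr, ho⟩ | ⟨hr, ho, hco⟩⟩
    · exact ⟨h1 ho, Or.inr ⟨hR.mp hr, hO.mp ho, h3 hr ho hΔ⟩⟩
    · exact ⟨h2 hco, Or.inl ⟨r'_of hr, o'_of ho⟩⟩
  · rintro ⟨hΔ', ⟨hr', ho'⟩ | ⟨hr', ho', hco'⟩⟩
    · exact ⟨h1' ho', Or.inr ⟨fun h ↦ hR.mp h hr', fun h ↦ hO.mp h ho', h3' hr' ho' hΔ'⟩⟩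
    · exact ⟨h2' hco', Or.inl ⟨hR.mpr hr', hO.mpr ho'⟩⟩

/-- **Type M₂ read at either end**: `Δ(W) > 0` with `P` unramified-odd or ramified-co-odd-not-odd iff the same for `(W', P')`.
[cite: GreenbergLNM1716, §5 Props. 5.13–5.14 and Remarks (chunks p0168–p0174)] -/
theorem typeM₂_iff_of_twoIsogeny (ha₁ : Odd (integralModelInt W).a₁) (ha₁' : Odd (integralModelInt W').a₁)
    [(C • W).IsTwoTorsionNF] (hlink : C' • W' = (C • W).twoIsogenyCodomain) :
    (0 < W.Δ ∧ ((¬ TwoTorsionRamifiedAtTwo C.r ∧ TwoTorsionOdd W C.r) ∨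
      (TwoTorsionRamifiedAtTwo C.r ∧ ¬ TwoTorsionOdd W C.r ∧
        ∀ r : ℝ, 4 * r ^ 3 + (W.b₂ : ℝ) * r ^ 2 + 2 * (W.b₄ : ℝ) * r + (W.b₆ : ℝ) = 0 → r ≤ (C.r : ℝ)))) ↔
    (0 < W'.Δ ∧ ((¬ TwoTorsionRamifiedAtTwo C'.r ∧ TwoTorsionOdd W' C'.r) ∨
      (TwoTorsionRamifiedAtTwo C'.r ∧ ¬ TwoTorsionOdd W' C'.r ∧
        ∀ r : ℝ, 4 * r ^ 3 + (W'.b₂ : ℝ) * r ^ 2 + 2 * (W'.b₄ : ℝ) * r + (W'.b₆ : ℝ) = 0 → r ≤ (C'.r : ℝ)))) := by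
  haveI : (C' • W').IsTwoTorsionNF := by rw [hlink]; infer_instance
  obtain ⟨hlink', hr''⟩ := smul_eq_twoIsogenyCodomain_partner W W' C C' hlink
  have hR := twoTorsionRamifiedAtTwo_iff_not_of_twoIsogeny W W' ha₁ ha₁' C C' hlink
  have hO := twoTorsionOdd_iff_not_of_twoIsogeny W W' C C' hlink
  have h1 : TwoTorsionOdd W C.r → 0 < W'.Δ := Δ_partner_pos_of_twoTorsionOdd W W' C C' hlink
  have h2 : (∀ r : ℝ, 4 * r ^ 3 + (W.b₂ : ℝ) * r ^ 2 + 2 * (W.b₄ : ℝ) * r + (W.b₆ : ℝ) = 0 → r ≤ (C.r : ℝ)) →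
      0 < W'.Δ := Δ_partner_pos_of_coodd W W' C C' hlink
  have h1' : TwoTorsionOdd W' C'.r → 0 < W.Δ := Δ_partner_pos_of_twoTorsionOdd W' W C' _ hlink'
  have h2' : (∀ r : ℝ, 4 * r ^ 3 + (W'.b₂ : ℝ) * r ^ 2 + 2 * (W'.b₄ : ℝ) * r + (W'.b₆ : ℝ) = 0 → r ≤ (C'.r : ℝ)) →
      0 < W.Δ := Δ_partner_pos_of_coodd W' W C' _ hlink'
  -- an odd point with `Δ > 0` at one end forces the other end's point to be extreme and not odd, i.e. co-odd
  have h4 : 0 < W.Δ → ¬ TwoTorsionOdd W' C'.r → ¬ (¬ ∀ r : ℝ, 4 * r ^ 3 + (W'.b₂ : ℝ) * r ^ 2 +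
      2 * (W'.b₄ : ℝ) * r + (W'.b₆ : ℝ) = 0 → r ≤ (C'.r : ℝ)) := by
    intro hΔ ho' hco'
    exact absurd ((Δ_neg_iff_partner_middle W W' C C' hlink).mpr ⟨ho', hco'⟩) (not_lt.mpr hΔ.le)
  have h4' : 0 < W'.Δ → ¬ TwoTorsionOdd W C.r → ¬ (¬ ∀ r : ℝ, 4 * r ^ 3 + (W.b₂ : ℝ) * r ^ 2 +
      2 * (W.b₄ : ℝ) * r + (W.b₆ : ℝ) = 0 → r ≤ (C.r : ℝ)) := by
    intro hΔ' ho hco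
    exact absurd ((Δ_partner_neg_iff_middle W W' C C' hlink).mpr ⟨ho, hco⟩) (not_lt.mpr hΔ'.le)
  have r'_of : ¬ TwoTorsionRamifiedAtTwo C.r → TwoTorsionRamifiedAtTwo C'.r := fun h ↦ by_contra fun h' ↦ h (hR.mpr h')
  have o'_of : ¬ TwoTorsionOdd W C.r → TwoTorsionOdd W' C'.r := fun h ↦ by_contra fun h' ↦ h (hO.mpr h')
  constructor
  · rintro ⟨hΔ, ⟨hr, ho⟩ | ⟨hr, ho, hco⟩⟩
    · exact ⟨h1 ho, Or.inr ⟨r'_of hr, hO.mp ho, not_not.mp (h4 hΔ (hO.mp ho))⟩⟩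
    · exact ⟨h2 hco, Or.inl ⟨hR.mp hr, o'_of ho⟩⟩
  · rintro ⟨hΔ', ⟨hr', ho'⟩ | ⟨hr', ho', hco'⟩⟩
    · exact ⟨h1' ho', Or.inr ⟨hR.mpr hr', fun h ↦ hO.mp h ho', not_not.mp (h4' hΔ' (fun h ↦ hO.mp h ho'))⟩⟩
    · exact ⟨h2' hco', Or.inl ⟨fun h ↦ hR.mp h hr', hO.mpr ho'⟩⟩

omit [W.IsGloballyMinimal] in
/-- **Every rational `2`-torsion point falls in exactly one of the four types** — exhaustiveness (a case split on the sign
of `Δ`, «ramified» and the real position; at `Δ < 0` the point is the unique real one, hence odd); exclusiveness is read off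
the sign of `Δ` and the flags. [cite: GreenbergLNM1716, §5 Remarks (chunks p0170, p0174)] -/
theorem type_cases [(C • W).IsTwoTorsionNF] :
    ((TwoTorsionRamifiedAtTwo C.r ∧ TwoTorsionOdd W C.r ∧ W.Δ < 0) ∨
      (¬ TwoTorsionRamifiedAtTwo C.r ∧ ¬ TwoTorsionOdd W C.r ∧
        ¬ ∀ r : ℝ, 4 * r ^ 3 + (W.b₂ : ℝ) * r ^ 2 + 2 * (W.b₄ : ℝ) * r + (W.b₆ : ℝ) = 0 → r ≤ (C.r : ℝ))) ∨
    ((¬ TwoTorsionRamifiedAtTwo C.r ∧ TwoTorsionOdd W C.r ∧ W.Δ < 0) ∨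
      (TwoTorsionRamifiedAtTwo C.r ∧ ¬ TwoTorsionOdd W C.r ∧
        ¬ ∀ r : ℝ, 4 * r ^ 3 + (W.b₂ : ℝ) * r ^ 2 + 2 * (W.b₄ : ℝ) * r + (W.b₆ : ℝ) = 0 → r ≤ (C.r : ℝ))) ∨
    (0 < W.Δ ∧ ((TwoTorsionRamifiedAtTwo C.r ∧ TwoTorsionOdd W C.r) ∨
      (¬ TwoTorsionRamifiedAtTwo C.r ∧ ¬ TwoTorsionOdd W C.r ∧
        ∀ r : ℝ, 4 * r ^ 3 + (W.b₂ : ℝ) * r ^ 2 + 2 * (W.b₄ : ℝ) * r + (W.b₆ : ℝ) = 0 → r ≤ (C.r : ℝ)))) ∨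
    (0 < W.Δ ∧ ((¬ TwoTorsionRamifiedAtTwo C.r ∧ TwoTorsionOdd W C.r) ∨
      (TwoTorsionRamifiedAtTwo C.r ∧ ¬ TwoTorsionOdd W C.r ∧
        ∀ r : ℝ, 4 * r ^ 3 + (W.b₂ : ℝ) * r ^ 2 + 2 * (W.b₄ : ℝ) * r + (W.b₆ : ℝ) = 0 → r ≤ (C.r : ℝ)))) := by
  have hΔ0 : W.Δ ≠ 0 := by rw [← W.coe_Δ']; exact W.Δ'.ne_zero
  rcases lt_trichotomy W.Δ 0 with hl | he | hg
  · have ho := twoTorsionOdd_smul_r_of_Δ_neg W C hl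
    by_cases hr : TwoTorsionRamifiedAtTwo C.r
    · exact Or.inl (Or.inl ⟨hr, ho, hl⟩)
    · exact Or.inr (Or.inl (Or.inl ⟨hr, ho, hl⟩))
  · exact absurd he hΔ0
  · have hnoc := not_odd_and_coodd_of_Δ_pos W C hg
    by_cases ho : TwoTorsionOdd W C.r
    · by_cases hr : TwoTorsionRamifiedAtTwo C.r
      · exact Or.inr (Or.inr (Or.inl ⟨hg, Or.inl ⟨hr, ho⟩⟩))
      · exact Or.inr (Or.inr (Or.inr ⟨hg, Or.inl ⟨hr, ho⟩⟩))
    · by_cases hco : ∀ r : ℝ, 4 * r ^ 3 + (W.b₂ : ℝ) * r ^ 2 + 2 * (W.b₄ : ℝ) * r + (W.b₆ : ℝ) = 0 → r ≤ (C.r : ℝ)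
      · by_cases hr : TwoTorsionRamifiedAtTwo C.r
        · exact Or.inr (Or.inr (Or.inr ⟨hg, Or.inr ⟨hr, ho, hco⟩⟩))
        · exact Or.inr (Or.inr (Or.inl ⟨hg, Or.inr ⟨hr, ho, hco⟩⟩))
      · by_cases hr : TwoTorsionRamifiedAtTwo C.r
        · exact Or.inr (Or.inl (Or.inr ⟨hr, ho, hco⟩))
        · exact Or.inl (Or.inr ⟨hr, ho, hco⟩)

end PairType

end Literature.NumberTheory.EllipticCurves.Greenberg1999
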